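import Literature.Geometry.Lorentzian.KerrIntegratedDecayUniform
import Literature.Geometry.Lorentzian.KerrSurfaceGravity

/-!
# Integrated local energy decay away from extremality, uniformly in `|a| ≤ a₁ < M`
# (stub `stub_integratedDecayAwayFromExtremal`, S6b of the line `olver-dunster-uniform-reduction`)

Crux `PhaseMixingCapture.KappaExplicitWaveDecay` (stmt-FinalStateConjecture-10654), line
`olver-dunster-uniform-reduction`, stub S6b: GIVEN the named fact
`DafermosRodnianskiShlapentokhRothman2016_integratedDecay_uniform`
(`Literature/Geometry/Lorentzian/KerrIntegratedDecayUniform.lean`: Dafermos–Rodnianski–Shlapentokh-Rothman,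
arXiv:1402.7034 = Ann. of Math. 183 (2016), Thm. 3.2 (25) with §3.3, p. 14 — integrated local energy
decay through admissible Kerr–Schild graphs flat on a ball, with ONE constant for all `|a| ≤ a₀`,
`a₀ < M` fixed first), for every `M > 0` and every `a₁ < M` there is `j` (`= 2`) such that for every
coordinate radius `R` some `C = C(M, a₁, R) < ∞` bounds
`∫₀^∞ E_loc(τ, R) dτ ≤ C · E_j[ψ](0)` for all `|a| ≤ a₁` and all admissible waves `ψ` on the Kerr
exterior `{r > r₊}` (smooth, `□_g ψ = 0`, data compactly supported on the leaf `{t*_KS = 0}`), where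
`E_j[ψ](0) = ∫ 𝟙_{(0,y) ∈ {r>r₊}} ∑_{m ≤ j} ‖D^m ψ̃(0, y)‖² dy` is the `j`-th order coordinate energy of
the zero extension `ψ̃` of `ψ` (`= sliceSobolevEnergy (Kerr.exterior M a) ψ 0 j 0 univ`).

Proof: the reduction `drsr_wave_integrated_decay_kerr_of_DRSR` of `KerrIntegratedDecay.lean`
(Dafermos–Rodnianski, arXiv:1010.5132, §4.6, Prop. 4.6.1: extension of the data, domain of
dependence, `T` timelike near infinity), run with every auxiliary scale depending on `(M, a₁, R)`
only. The one `a`-dependent scale of that proof is the far radius `R_far(M, a)`; for `|a| < M` it is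
at most `293 M + 2` (`r₊ ≤ 2M`, `√(r₊² + a²) ≤ 3M`), so with `B` a bound for `|heightProfile'|`,
`A = 4MB + 2M`, `s` the universal speed of `kerr_far_finite_speed_of_propagation` and `R₀ = R₀(M, a₁)`
the radius of the fact, the scale `λ = max (4A, 4Ms, 293M + 2, R₀, R)` and the height function
`F = heightFn M λ` (admissible, slope `≤ 1/4`, `F = 0` on `{‖y‖ ≤ λ}`, `0 ≤ sF ≤ ‖y‖/2`) do not
depend on `a`, and the fact yields ONE constant `C = C(M, a₁, F, λ, R)` for all `|a| ≤ a₁`. For each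
such `a` (sub-extremal) and each admissible `φ`, finite speed of propagation makes `φ, dφ` vanish on
`{x⁰ ≥ 0, ‖x⃗‖ > ρ + s x⁰}` (`ρ ≥ R_far(M, a)` enclosing the data), so `φ` has compactly supported
data on the graph of `F` and vanishes on the wedge `{0 ≤ x⁰ ≤ F(x⃗)}` beyond `‖x⃗‖ = 2ρ + 1`; the far
`J^T` identity (`kerr_far_TEnergy_comparison_of_farRadius_le`) gives `E^far_F[φ](0) ≤ 8 sliceEnergy φ 0`.
Applied to `ψ` and `Tψ` (`IsAdmissibleKerrWave.timeDeriv`), with `sliceEnergy ψ 0 ≤ 4 E₂[ψ](0)`,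
`sliceEnergy (Tψ) 0 ≤ 4 E₂[ψ](0)`, `E₂(ball) ≤ E₂(univ)`: the fact's right-hand side is at most
`65 E₂[ψ](0)`, and `E₂[ψ](0)` is the clause's right-hand side with `j = 2` (weight `(1 + ‖y‖)^0 = 1`).
For `a₁ < 0` the range `|a| ≤ a₁` is empty and `C = 0` serves.
-/

-- the doubled `FinalStateConjecture.FinalStateConjecture` path component trips dupNamespace
set_option linter.dupNamespace false

noncomputable section

namespace Summit.FinalStateConjecture.FinalStateConjecture.Theorems.KappaExplicitWaveDecay.OlverDunsterUniformReduction

open Literature.Geometry.Lorentzian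
open MeasureTheory Filter Set Complex
open scoped Topology Manifold ENNReal ContDiff

/-- **An `a`-uniform far radius**: `R_far(M, a) ≤ 293 M + 2` for sub-extremal `(M, a)`, since
`R_far = max (R_af + 1) (290 M)`, `R_af = √(r₊² + a²) + 1`, `0 < r₊ ≤ 2M` and `|a| < M`. -/
private theorem farRadius_le_of_isSubextremal {M a : ℝ} (hMa : Kerr.IsSubextremal M a) :
    Kerr.farRadius M a ≤ 293 * M + 2 := by
  have hM : 0 < M := hMa.pos
  have hr : Kerr.rPlus M a ≤ 2 * M := Kerr.rPlus_le_two_mul_self hM.le a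
  have hr0 : 0 < Kerr.rPlus M a := Kerr.rPlus_pos hM a
  have ha : |a| < M := hMa
  have ha2 : a ^ 2 ≤ M ^ 2 := by
    rw [← sq_abs a]
    exact pow_le_pow_left₀ (abs_nonneg a) ha.le 2
  have hsqrt : √((max (Kerr.rPlus M a) 0) ^ 2 + a ^ 2) ≤ 3 * M := by
    rw [max_eq_left hr0.le, Real.sqrt_le_left (by positivity)]
    nlinarith
  unfold Kerr.farRadius Kerr.afRadius
  exact max_le (by linarith) (by linarith)

/-- The clause's right-hand side with `j = 2` is the second-order coordinate energy of the data,
`sliceSobolevEnergy (Kerr.exterior M a) ψ 0 2 0 univ` (the weight `(1 + ‖y‖)^0 = 1` drops). -/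
private theorem sliceSobolevEnergy_two_zero_univ_eq [Kerr.Facts] [Kerr.SliceFacts] (M a : ℝ)
    (ψ : Kerr.exterior M a → ℝ) :
    sliceSobolevEnergy (Kerr.exterior M a) ψ 0 2 0 univ =
      ∫⁻ y : E3, {y | E4.ofTimeSpace 0 y ∈ Kerr.exterior M a}.indicator (fun y ↦
        ENNReal.ofReal (∑ m ∈ Finset.range (2 + 1), ‖iteratedFDeriv ℝ m
          (Function.extend Subtype.val ψ (0 : E4 → ℝ)) (E4.ofTimeSpace 0 y)‖ ^ 2)) y := by
  simp only [sliceSobolevEnergy, Measure.restrict_univ, Real.rpow_zero, one_mul]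

/-- **S6b · `stub_integratedDecayAwayFromExtremal`** — integrated local energy decay on the range
`|a| ≤ a₁ < M` with a constant depending on `(M, a₁, R)` only (no `κ`), from the named fact
`DafermosRodnianskiShlapentokhRothman2016_integratedDecay_uniform` (DRSR arXiv:1402.7034, Thm. 3.2
(25) with §3.3: "`C` depends only on `a₀`, `M`"): for `M > 0`, `a₁ < M` there is `j = 2` such that
for every `R` some `C < ∞` gives `∫₀^∞ E_loc(τ, R) dτ ≤ C · E₂[ψ](0)` for all `|a| ≤ a₁` and all
admissible `ψ`. Proof: the reduction `drsr_wave_integrated_decay_kerr_of_DRSR`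
(`KerrIntegratedDecay.lean`; Dafermos–Rodnianski arXiv:1010.5132, §4.6, Prop. 4.6.1) with the
`a`-uniform scale `λ = max (4A, 4Ms, 293M + 2, R₀(M, a₁), R)` (`farRadius_le_of_isSubextremal`),
height function `heightFn M λ`, finite speed of propagation
(`kerr_far_finite_speed_of_propagation`), the far `J^T` identity
(`kerr_far_TEnergy_comparison_of_farRadius_le`) for `ψ` and `Tψ`, and the energy comparisons
`sliceEnergy ≤ 4 E₂`; constant `65 C`. For `a₁ < 0` the range is empty. -/
theorem stub_integratedDecayAwayFromExtremal : DafermosRodnianskiShlapentokhRothman2016_integratedDecay_uniform → (∀ [Kerr.Facts] [Kerr.SliceFacts], ∀ M : ℝ, 0 < M → ∀ a₁ : ℝ, a₁ < M → ∃ j : ℕ, ∀ R : ℝ, ∃ C : ENNReal, C < ⊤ ∧ ∀ a : ℝ, |a| ≤ a₁ → ∀ ψ : Kerr.exterior M a → ℝ, (ContMDiff 𝓘(ℝ, E4) 𝓘(ℝ, ℝ) ((⊤ : ℕ∞) : WithTop ℕ∞) ψ ∧ (∀ x, (Kerr.smoothMetric M a (Kerr.rPlus M a)).toPseudoRiemannianMetric.dalembertian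 ψ x = 0) ∧ ∃ K : Set (Kerr.exterior M a), IsCompact K ∧ ∀ x : Kerr.exterior M a, (x : E4) 0 = 0 → x ∉ K → ψ x = 0 ∧ mfderiv 𝓘(ℝ, E4) 𝓘(ℝ, ℝ) ψ x = 0) → ∫⁻ τ in Ioi (0 : ℝ), localSliceEnergy (Kerr.exterior M a) ψ τ R ≤ C * ∫⁻ y : E3, {y | E4.ofTimeSpace 0 y ∈ Kerr.exterior M a}.indicator (fun y ↦ ENNReal.ofReal (∑ m ∈ Finset.range (j + 1), ‖iteratedFDeriv ℝ m (Function.extend Subtype.val ψ (0 : E4 → ℝ)) (E4.ofTimeSpace 0 y)‖ ^ 2)) y) := by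
  intro h25 instF instS M hM a₁ ha₁
  refine ⟨2, fun R ↦ ?_⟩
  rcases lt_or_ge a₁ 0 with hneg | ha₁0
  · -- the range `|a| ≤ a₁ < 0` is empty
    exact ⟨0, ENNReal.zero_lt_top, fun a ha ↦ absurd (ha.trans_lt hneg) (not_lt.mpr (abs_nonneg a))⟩
  obtain ⟨s, hs1, hCfar⟩ := kerr_far_finite_speed_of_propagation
  have hs0 : 0 ≤ s := zero_le_one.trans hs1
  -- ### the radius and the constant of the printed theorem, for the whole range `|a| ≤ a₁`
  obtain ⟨R₀, -, h25'⟩ := h25 M a₁ ha₁0 ha₁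
  -- ### the height function and its `a`-uniform scale
  obtain ⟨B, hB0, hBd⟩ := exists_bound_deriv_heightProfile
  set A : ℝ := 4 * M * B + 2 * M with hA_def
  have hA0 : 0 ≤ A := by positivity
  set l : ℝ := max (max (max (4 * A) (4 * M * s)) (293 * M + 2)) (max R₀ R) with hl_def
  have hl_A : 4 * A ≤ l := ((le_max_left _ _).trans (le_max_left _ _)).trans (le_max_left _ _)
  have hl_s : 4 * M * s ≤ l :=
    ((le_max_right _ _).trans (le_max_left _ _)).trans (le_max_left _ _)
  have hl_unif : 293 * M + 2 ≤ l := (le_max_right _ _).trans (le_max_left _ _)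
  have hl_R₀ : R₀ ≤ l := (le_max_left _ _).trans (le_max_right _ _)
  have hl_R : R ≤ l := (le_max_right _ _).trans (le_max_right _ _)
  have hl : 0 < l := (by positivity : (0 : ℝ) < 293 * M + 2).trans_le hl_unif
  set F : E3 → ℝ := heightFn M l with hF_def
  have hF_smooth : ContDiff ℝ ∞ F := contDiff_heightFn M l
  have hF_C1 : ContDiff ℝ 1 F := hF_smooth.of_le (ENat.natCast_le_of_coe_top_le_withTop le_rfl 1)
  have hF_slope : ∀ y : E3, ‖fderiv ℝ F y‖ ≤ 1 / 4 := by
    intro y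
    have h := norm_fderiv_heightFn_le_div hM.le hl hB0 hBd y
    have h2 : A / l ≤ 1 / 4 := by
      rw [div_le_iff₀ hl]; linarith
    rw [← hA_def] at h
    linarith
  have hF_zero : ∀ y : E3, ‖y‖ ≤ l → F y = 0 := fun y hy ↦ heightFn_of_norm_le hl hy
  have hF_nonneg : ∀ y : E3, 0 ≤ F y := heightFn_nonneg hM.le l
  have hF_sF : ∀ y : E3, s * F y ≤ ‖y‖ / 2 := by
    intro y
    have h := heightFn_le hM.le hl y
    have h1 : s * F y ≤ s * (2 * M * ‖y‖ / l) := mul_le_mul_of_nonneg_left h hs0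
    have h2 : s * (2 * M * ‖y‖ / l) ≤ ‖y‖ / 2 := by
      rw [← mul_div_assoc, div_le_div_iff₀ hl (by norm_num : (0:ℝ) < 2)]
      nlinarith [norm_nonneg y]
    exact h1.trans h2
  have hF_adm : Kerr.IsAdmissibleHeight M F :=
    ⟨hF_smooth, ⟨3 / 4, by norm_num, fun y ↦ by linarith [hF_slope y]⟩, _,
      tendsto_heightFn_sub_log hl⟩
  have hzero_C1 : ContDiff ℝ 1 (0 : E3 → ℝ) := contDiff_const
  have hzero_slope : ∀ y : E3, ‖fderiv ℝ (0 : E3 → ℝ) y‖ ≤ 1 / 4 := by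
    intro y; simp
  -- ### the printed theorem for the graph of `F`, flat on `{‖y‖ ≤ λ}`: ONE constant for `|a| ≤ a₁`
  obtain ⟨C, hC, h25ψ⟩ := h25' F l hF_adm hl_R₀ hF_zero R hl_R
  refine ⟨65 * C, ENNReal.mul_lt_top (by simp) hC, fun a ha ψ hψ ↦ ?_⟩
  -- ### a spin in the range: sub-extremal, with far radius below the uniform scale
  have hMa : Kerr.IsSubextremal M a := lt_of_le_of_lt ha ha₁
  have hl_far : Kerr.farRadius M a ≤ l := (farRadius_le_of_isSubextremal hMa).trans hl_unif
  have hl_af : Kerr.afRadius a (Kerr.rPlus M a) < l :=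
    (Kerr.afRadius_lt_farRadius M a).trans_le hl_far
  have hψ' : IsAdmissibleKerrWave M a ψ := hψ
  -- ### KEY: an admissible wave has compactly supported data on the graph of `F`, and its
  -- energy through the far part of the graph is at most `8 ×` its energy through `{t* = 0}`
  have key : ∀ φ : Kerr.exterior M a → ℝ, IsAdmissibleKerrWave M a φ →
      IsAdmissibleKerrWaveOn M a F φ ∧
        graphSliceEnergyOn (Kerr.exterior M a) φ F 0 {y | l < ‖y‖} ≤
          8 * sliceEnergy (Kerr.exterior M a) φ 0 := by
    intro φ hφ
    obtain ⟨hsmooth, hsol, K, hK, hdata⟩ := hφ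
    obtain ⟨ρ₀, -, hρ₀⟩ := exists_spatialNorm_le_of_isCompact hK
    set ρ : ℝ := max ρ₀ (Kerr.farRadius M a) with hρ_def
    have hρfar : Kerr.farRadius M a ≤ ρ := le_max_right _ _
    have hρ0 : 0 ≤ ρ := (Kerr.farRadius_pos M a).le.trans hρfar
    have hρ : ∀ x ∈ K, E4.spatialNorm (x : E4) ≤ ρ := fun x hx ↦
      (hρ₀ x hx).trans (le_max_left _ _)
    -- finite speed of propagation (far region, speed `s`)
    have hvan : ∀ x : Kerr.exterior M a, 0 ≤ (x : E4) 0 →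
        ρ + s * (x : E4) 0 < E4.spatialNorm (x : E4) →
        φ x = 0 ∧ mfderiv 𝓘(ℝ, E4) 𝓘(ℝ, ℝ) φ x = 0 := by
      refine hCfar M a hMa φ hsmooth hsol ρ hρfar fun x hx0 hxρ ↦ hdata x hx0 fun hxK ↦ ?_
      exact absurd (hρ x hxK) (not_le.mpr hxρ)
    -- `φ` has compactly supported data on the graph of `F`
    have hφF : IsAdmissibleKerrWaveOn M a F φ := by
      refine ⟨hsmooth, hsol, ?_⟩
      set B₂ : Set E4 := (fun y : E3 ↦ E4.ofTimeSpace (F y) y) '' {y | l ≤ ‖y‖ ∧ ‖y‖ ≤ 2 * ρ}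
        with hB₂_def
      have hB₂c : IsCompact B₂ := by
        refine IsCompact.image ?_ ?_
        · have : {y : E3 | l ≤ ‖y‖ ∧ ‖y‖ ≤ 2 * ρ} =
              {y | l ≤ ‖y‖} ∩ Metric.closedBall 0 (2 * ρ) := by
            ext y; simp [Metric.mem_closedBall, dist_zero_right]
          rw [this]
          exact (isCompact_closedBall _ _).inter_left
            (isClosed_le continuous_const continuous_norm)
        · exact E4.continuous_ofTimeSpace' hF_smooth.continuous continuous_id
      have hB₂sub : B₂ ⊆ (Kerr.exterior M a : Set E4) := by
        rintro _ ⟨y, ⟨hy1, _⟩, rfl⟩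
        exact Kerr.ofTimeSpace_mem_exterior_iff.mpr
          (Kerr.mem_slice_of_lt_norm (hl_af.trans_le hy1))
      set K' : Set (Kerr.exterior M a) := K ∪ Subtype.val ⁻¹' B₂ with hK'_def
      have hK'c : IsCompact K' := by
        refine hK.union ?_
        have hrange : B₂ ⊆ Set.range (Subtype.val : Kerr.exterior M a → E4) :=
          fun x hx ↦ ⟨⟨x, hB₂sub hx⟩, rfl⟩
        rw [Topology.IsEmbedding.subtypeVal.isCompact_iff, Set.image_preimage_eq_of_subset hrange]
        exact hB₂c
      refine ⟨K', hK'c, fun x hx0 hxK' ↦ ?_⟩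
      set y : E3 := E4.spatial (x : E4) with hy_def
      have hxy : (x : E4) = E4.ofTimeSpace (F y) y := by rw [← hx0]; exact eq_ofTimeSpace _
      have hsn : E4.spatialNorm (x : E4) = ‖y‖ := rfl
      by_cases hfar : 2 * ρ < ‖y‖
      · refine hvan x (hx0 ▸ hF_nonneg y) ?_
        rw [hsn, hx0]
        have hh := hF_sF y
        nlinarith [hF_nonneg y]
      · push Not at hfar
        by_cases hnear : l ≤ ‖y‖
        · exact absurd (Or.inr ⟨y, ⟨hnear, hfar⟩, hxy.symm⟩ : x ∈ K') hxK'
        · push Not at hnear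
          have h0 : (x : E4) 0 = 0 := by rw [hx0, hF_zero y hnear.le]
          exact hdata x h0 fun hxK ↦ hxK' (Or.inl hxK)
    refine ⟨hφF, ?_⟩
    -- the far `J^T` identity between the leaf `{t* = 0}` and the graph of `F` (a theorem)
    have hB := kerr_far_TEnergy_comparison_of_farRadius_le hMa hl_far (F₁ := 0) (F₂ := F)
      hzero_C1 hF_C1 hzero_slope hF_slope (fun y hy ↦ by simp [hF_zero y hy])
      (fun y ↦ by simpa using hF_nonneg y) φ 0 hsmooth hsol
      ⟨2 * ρ + 1, fun x hx1 hx2 hx3 ↦ by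
        simp only [Pi.zero_apply, add_zero] at hx1
        simp only [zero_add] at hx2
        refine hvan x hx1 ?_
        have hsn : E4.spatialNorm (x : E4) = ‖E4.spatial (x : E4)‖ := rfl
        have hh := hF_sF (E4.spatial (x : E4))
        have h2 := mul_le_mul_of_nonneg_left hx2 hs0
        rw [hsn] at hx3 ⊢
        nlinarith⟩
    calc graphSliceEnergyOn (Kerr.exterior M a) φ F 0 {y | l < ‖y‖}
        ≤ 8 * graphSliceEnergyOn (Kerr.exterior M a) φ 0 0 {y | l < ‖y‖} := hB.1
      _ ≤ 8 * graphSliceEnergy (Kerr.exterior M a) φ 0 0 := by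
          gcongr
          exact graphSliceEnergyOn_le _ _ _ _ _
      _ = 8 * sliceEnergy (Kerr.exterior M a) φ 0 := by rw [graphSliceEnergy_zero_height]
  -- ### the assembly for `ψ` and `Tψ`
  obtain ⟨hψF, hfarψ⟩ := key ψ hψ'
  obtain ⟨-, hfarTψ⟩ := key (timeDeriv ψ) (hψ'.timeDeriv hM.le)
  rw [← sliceSobolevEnergy_two_zero_univ_eq M a ψ]
  set S₂ : ℝ≥0∞ := sliceSobolevEnergy (Kerr.exterior M a) ψ 0 2 0 univ with hS₂_def
  have h1 : sliceSobolevEnergy (Kerr.exterior M a) ψ 0 2 0 (Metric.closedBall (0 : E3) l) ≤ S₂ :=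
    sliceSobolevEnergy_mono _ _ _ _ _ (subset_univ _)
  have h2 : graphSliceEnergyOn (Kerr.exterior M a) ψ F 0 {y | l < ‖y‖} ≤ 8 * (4 * S₂) :=
    hfarψ.trans (by
      gcongr
      exact sliceEnergy_le_four_mul_sliceSobolevEnergy _ ψ 0 1)
  have h3 : graphSliceEnergyOn (Kerr.exterior M a) (timeDeriv ψ) F 0 {y | l < ‖y‖} ≤
      8 * (4 * S₂) :=
    hfarTψ.trans (by
      gcongr
      exact sliceEnergy_timeDeriv_le_four_mul_sliceSobolevEnergy hψ'.contMDiff 0 0)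
  calc ∫⁻ τ in Ioi (0 : ℝ), localSliceEnergy (Kerr.exterior M a) ψ τ R
      ≤ C * (sliceSobolevEnergy (Kerr.exterior M a) ψ 0 2 0 (Metric.closedBall (0 : E3) l) +
          graphSliceEnergyOn (Kerr.exterior M a) ψ F 0 {y | l < ‖y‖} +
          graphSliceEnergyOn (Kerr.exterior M a) (timeDeriv ψ) F 0 {y | l < ‖y‖}) :=
        h25ψ a ha ψ hψF
    _ ≤ C * (S₂ + 8 * (4 * S₂) + 8 * (4 * S₂)) := by gcongr
    _ = 65 * C * S₂ := by ring

end Summit.FinalStateConjecture.FinalStateConjecture.Theorems.KappaExplicitWaveDecay.OlverDunsterUniformReduction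

end
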